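import Summits.AtomisticToContinuum.HydrodynamicLimit.Theses.JParityClosure

/-!
# Negative knowledge for crux `JParityClosure.OddContactSymmetry` (stmt-AtomisticToContinuum-17722, rev 5;
# originally filed against the retired rev-1 item 13078): any refutation must construct the hard-sphere flow

From the standing disprover's `Cruxes/OddContactSymmetry/Disproof.lean` (refuter-cdisprove-stmt-AtomisticToContinuum-13078-0,
2026-08-16; proof re-threaded through the rev-5 binders `T ρ θ u`, `IsHardSphereEulerSolution`, by
refuter-cdisprove-stmt-AtomisticToContinuum-17722-0, 2026-08-17 — statement unchanged).  The crux quantifies `∀ Φ : (N : ℕ) → HardSphereFlow 𝕋³ (hsDiameter σ N) (N+1)` over a hypothesis structure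
that is pinned down Liouville-a.e. (conull invariant good set, hard-sphere trajectories on it, Liouville-preserving maps;
`localGibbsLaw ≪ liouville`), so no junk-flow / small-model attack exists; `not_oddContactSymmetry_requires_flows` records
the formal dual: a proof of `¬ OddContactSymmetry` yields, below every `σ₀`, an inhabitant of the full flow-family type at
some `σ ∈ (0, σ₀)` — Alexander's theorem for all particle numbers at that reduced density (a sorried tree fact,
`HardSphereFlow.nonempty_torus`).  Consequence: a kill can only come from the physics and is a research-level construction.
-/

noncomputable section

namespace Summit.AtomisticToContinuum.HydrodynamicLimit.Theorems

namespace OddContactSymmetryNegative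

open Summit.AtomisticToContinuum.HydrodynamicLimit.Theses.JParityClosure
open Literature.Analysis.FluidPDE Literature.MathematicalPhysics.KineticTheory

/-- **Any disproof constructs the hard-sphere flow.**  If `OddContactSymmetry` fails then, for every threshold `η₀ > 0`,
there are admissible profiles such that below EVERY `σ₀` some reduced density `σ` carries an inhabitant of the full family
type `(N : ℕ) → HardSphereFlow 𝕋³ (hsDiameter σ N) (N+1)` — i.e. a refuter must prove Alexander's theorem (for all particle
numbers, at that `σ`) on the way.  Pure logic: the flows are universally quantified in the crux. [folklore] -/
theorem not_oddContactSymmetry_requires_flows (h : ¬ OddContactSymmetry) {η₀ : ℝ} (hη₀ : 0 < η₀) :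
    ∃ (a₀ θ₀ : T3 → ℝ) (u₀ : T3 → V3), Continuous a₀ ∧ Continuous θ₀ ∧ Continuous u₀ ∧
      (∀ x, 0 < a₀ x) ∧ (∀ x, 0 < θ₀ x) ∧
      ∀ σ₀ : ℝ, 0 < σ₀ → ∃ σ : ℝ, 0 < σ ∧ σ < σ₀ ∧
        Nonempty ((N : ℕ) → HardSphereFlow (Torus.geometry (Fin 3)) (hsDiameter σ N) (N + 1)) := by
  classical
  by_contra hne
  push Not at hne
  apply h
  refine ⟨η₀, hη₀, ?_⟩
  intro a₀ θ₀ u₀ ha hθ hu hpa hpθ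
  obtain ⟨σ₀, hσ₀, hempty⟩ := hne a₀ θ₀ u₀ ha hθ hu hpa hpθ
  refine ⟨σ₀, hσ₀, ?_⟩
  intro σ hσ hσσ T ρ θ u _ Φ
  exact ((hempty σ hσ hσσ).false Φ).elim

end OddContactSymmetryNegative

end Summit.AtomisticToContinuum.HydrodynamicLimit.Theorems
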